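import Mathlib.Analysis.Normed.Operator.Extend
import Mathlib.Analysis.InnerProductSpace.Basic
import Mathlib.LinearAlgebra.Finsupp.LinearCombination
import Mathlib.Topology.Algebra.Module.ContinuousLinearMap.Basic
import Literature.NumberTheory.Automorphic.HilbertRepSpectrum
import HarnessLib

/-!
# Equal Gram kernels ⇒ unitary equivalence: the uniqueness half of the Gelfand–Naimark–Segal / Moore–Aronszajn
# construction, for families of vectors and for unitary representations

Topic `RepresentationTheory`; namespace `Literature.RepresentationTheory`.  THEOREMS ONLY (no definition, no named
fact, no instance, no notation), over Mathlib (`LinearEquiv.extendOfIsometry`, `Finsupp.linearCombination`,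
`ContinuousLinearMap.ext_on`, `ContRepresentation.Equiv.mk`) and the tree's Hilbert-space representation vocabulary ★
`Literature/NumberTheory/Automorphic/HilbertRepSpectrum` (`ContRepresentation.IsUnitary`, `IsTopIrreducible`,
`ClosedSubrep`, `AreUnitarilyEquivalent`).

§1 (Hilbert spaces).  Two families `v : ι → E`, `w : ι → E′` of vectors in Hilbert spaces with THE SAME GRAM KERNEL
`⟪v i, v j⟫ = ⟪w i, w j⟫` and dense linear spans are exchanged by a UNIQUE unitary `U : E ≃ₗᵢ E′`, `U (v i) = w i`
(`exists_linearIsometryEquiv_of_inner_eq`, `continuousLinearMap_unique_of_dense_span`): the Gram identity gives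
`‖Σ cᵢ w i‖ = ‖Σ cᵢ v i‖` on finitely supported coefficient vectors (`norm_linearCombination_eq_of_inner_eq`), so the
identity of the free module `ι →₀ 𝕜` extends along the two dense evaluation maps (Mathlib `LinearEquiv.extendOfIsometry`).
This is the uniqueness statement of the reproducing-kernel / GNS construction: a Hilbert space generated by a family
of vectors is determined up to unitary isomorphism by the kernel `(i, j) ↦ ⟪v i, v j⟫` (Aronszajn 1950, Part I §2
(uniqueness in the Moore theorem); for states of `C*`-algebras Dixmier 1977, Prop. 2.4.1 (uniqueness of the GNS
triple); for positive-definite functions on groups Folland 1995, Prop. 3.15 / Thm. 3.20 (uniqueness of the cyclic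
representation with a given matrix coefficient)).
§2 (representations).  For continuous representations `π`, `π′` of a group `G` on complex Hilbert spaces and families
`v`, `w` with equal ORBIT GRAM KERNELS `⟪π g (v i), π h (v j)⟫ = ⟪π′ g (w i), π′ h (w j)⟫` and dense spans of the orbits
`G · v`, `G · w`, the unitary of §1 on the index set `G × ι` INTERTWINES: `∃ e : π.Equiv π′, Isometry e ∧ e (v i) = w i`
(`exists_equiv_isometry_of_inner_orbit_eq`), hence `AreUnitarilyEquivalent π π′`; for UNITARY `π`, `π′` the hypothesis
is the equality of MATRIX COEFFICIENTS `⟪π g (v i), v j⟫ = ⟪π′ g (w i), w j⟫` (`inner_orbit_eq_of_matrixCoeff_eq`).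
§3 (irreducible case).  For a topologically IRREDUCIBLE `π` the closed span of the orbit of any non-zero family is
everything (`dense_span_orbit_of_isTopIrreducible`), so two irreducible unitary representations with a pair of non-zero
families of vectors having the same matrix coefficients are unitarily equivalent by an equivalence matching the families
(`exists_equiv_isometry_of_matrixCoeff_eq_of_isTopIrreducible`, `areUnitarilyEquivalent_of_matrixCoeff_eq`) — the form
in which «an irreducible unitary representation is determined by one non-zero diagonal matrix coefficient»
(Folland 1995, Cor. 3.24; Dixmier 1977, 13.1.3 with Prop. 2.4.1) is consumed by the cell (floor-0 programme P5 of
`hodgecm-mathlib`, K-E1′₂ «rank-2 collapse»: two discrete automorphic representations whose holomorphic cotangent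
classes have proportional matrix coefficients are unitarily equivalent).
NOT here: existence (the RKHS / GNS space of a positive-definite kernel is Mathlib's `RKHS.OfKernel`); positive-definite
functions; cyclic vectors as a notion.

## References
* N. Aronszajn, *Theory of reproducing kernels*, Trans. AMS 68 (1950), Part I §2 [Aronszajn1950].
* J. Dixmier, *C\*-algebras* (1977), Prop. 2.4.1, 13.1.3 [Dixmier1977].
* G. B. Folland, *A Course in Abstract Harmonic Analysis* (1995), §3.3 Prop. 3.15, Thm. 3.20, Cor. 3.24 [Folland1995].
-/

set_option autoImplicit false

noncomputable section

open scoped InnerProductSpace ComplexConjugate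

namespace Literature.RepresentationTheory

/-! ## §1 Hilbert spaces: a Gram-preserving correspondence of total families extends to a unitary -/

section Gram

variable {𝕜 : Type*} [RCLike 𝕜] {E E' : Type*} [NormedAddCommGroup E] [InnerProductSpace 𝕜 E]
  [NormedAddCommGroup E'] [InnerProductSpace 𝕜 E'] {ι : Type*} (v : ι → E) (w : ι → E')

/-- Equal Gram kernels give equal inner products of all finite linear combinations:
`⟪Σ cᵢ v i, Σ dⱼ v j⟫ = ⟪Σ cᵢ w i, Σ dⱼ w j⟫`. [cite: Aronszajn1950, Part I §2] -/
theorem inner_linearCombination_eq_of_inner_eq (h : ∀ i j, ⟪v i, v j⟫_𝕜 = ⟪w i, w j⟫_𝕜) (c d : ι →₀ 𝕜) :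
    ⟪Finsupp.linearCombination 𝕜 v c, Finsupp.linearCombination 𝕜 v d⟫_𝕜 =
      ⟪Finsupp.linearCombination 𝕜 w c, Finsupp.linearCombination 𝕜 w d⟫_𝕜 := by
  simp only [Finsupp.linearCombination_apply, Finsupp.sum_inner, Finsupp.inner_sum, inner_smul_left,
    inner_smul_right, h]

/-- Equal Gram kernels give equal norms of all finite linear combinations: `‖Σ cᵢ w i‖ = ‖Σ cᵢ v i‖`.
[cite: Aronszajn1950, Part I §2] -/
theorem norm_linearCombination_eq_of_inner_eq (h : ∀ i j, ⟪v i, v j⟫_𝕜 = ⟪w i, w j⟫_𝕜) (c : ι →₀ 𝕜) :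
    ‖Finsupp.linearCombination 𝕜 w c‖ = ‖Finsupp.linearCombination 𝕜 v c‖ := by
  rw [norm_eq_sqrt_re_inner (𝕜 := 𝕜), norm_eq_sqrt_re_inner (𝕜 := 𝕜) (Finsupp.linearCombination 𝕜 v c),
    inner_linearCombination_eq_of_inner_eq v w h]

omit [InnerProductSpace 𝕜 E'] in
/-- The evaluation map `c ↦ Σ cᵢ v i` of the free module has dense range iff the span of the family is dense
(plumbing for `exists_linearIsometryEquiv_of_inner_eq`). [cite: Aronszajn1950, Part I §2] -/
theorem denseRange_linearCombination_iff :
    DenseRange (Finsupp.linearCombination 𝕜 v) ↔ Dense (Submodule.span 𝕜 (Set.range v) : Set E) := by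
  rw [DenseRange, ← LinearMap.coe_range, Finsupp.range_linearCombination]

variable [CompleteSpace E] [CompleteSpace E']

/-- **Equal Gram kernels ⇒ a unitary exchanging the families.**  If `⟪v i, v j⟫ = ⟪w i, w j⟫` for all `i, j` and both
families have dense span, there is a surjective linear isometry `U : E ≃ₗᵢ E′` with `U (v i) = w i` — the identity of
`ι →₀ 𝕜` extended along the two dense evaluation maps (Mathlib `LinearEquiv.extendOfIsometry`), norm-preserving by
`norm_linearCombination_eq_of_inner_eq`.  Uniqueness of the Moore–Aronszajn / GNS space.
[cite: Aronszajn1950, Part I §2] [cite: Dixmier1977, Prop. 2.4.1] -/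
theorem exists_linearIsometryEquiv_of_inner_eq (h : ∀ i j, ⟪v i, v j⟫_𝕜 = ⟪w i, w j⟫_𝕜)
    (hv : Dense (Submodule.span 𝕜 (Set.range v) : Set E)) (hw : Dense (Submodule.span 𝕜 (Set.range w) : Set E')) :
    ∃ U : E ≃ₗᵢ[𝕜] E', ∀ i, U (v i) = w i := by
  have hv' : DenseRange (Finsupp.linearCombination 𝕜 v) := (denseRange_linearCombination_iff v).2 hv
  have hw' : DenseRange (Finsupp.linearCombination 𝕜 w) := (denseRange_linearCombination_iff w).2 hw
  refine ⟨(LinearEquiv.refl 𝕜 (ι →₀ 𝕜)).extendOfIsometry (Finsupp.linearCombination 𝕜 v)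
    (Finsupp.linearCombination 𝕜 w) hv' hw' (fun c => norm_linearCombination_eq_of_inner_eq v w h c), fun i => ?_⟩
  have := LinearEquiv.extendOfIsometry_eq (LinearEquiv.refl 𝕜 (ι →₀ 𝕜)) (Finsupp.linearCombination 𝕜 v)
    (Finsupp.linearCombination 𝕜 w) hv' hw' (fun c => norm_linearCombination_eq_of_inner_eq v w h c) (Finsupp.single i 1)
  simpa only [LinearEquiv.refl_apply, Finsupp.linearCombination_single, one_smul] using this

omit [CompleteSpace E] [CompleteSpace E'] [InnerProductSpace 𝕜 E'] in
/-- **Uniqueness**: a continuous linear map is determined by its values on a family with dense span; in particular the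
unitary of `exists_linearIsometryEquiv_of_inner_eq` is unique. [cite: Aronszajn1950, Part I §2] -/
theorem continuousLinearMap_unique_of_dense_span [NormedSpace 𝕜 E'] (hv : Dense (Submodule.span 𝕜 (Set.range v) : Set E))
    {U U' : E →L[𝕜] E'} (hU : ∀ i, U (v i) = w i) (hU' : ∀ i, U' (v i) = w i) : U = U' :=
  ContinuousLinearMap.ext_on hv (by rintro _ ⟨i, rfl⟩; rw [hU i, hU' i])

end Gram

/-! ## §2 Representations: equal orbit Gram kernels ⇒ an isometric equivalence of representations -/

section Rep

open Literature.NumberTheory.Automorphic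

variable {G : Type*} [Group G] {E E' : Type*} [NormedAddCommGroup E] [InnerProductSpace ℂ E] [CompleteSpace E]
  [NormedAddCommGroup E'] [InnerProductSpace ℂ E'] [CompleteSpace E']
  (π : ContRepresentation ℂ G E) (π' : ContRepresentation ℂ G E') {ι : Type*} (v : ι → E) (w : ι → E')

/-- **Equal orbit Gram kernels ⇒ an isometric equivalence of representations matching the families.**  If
`⟪π g (v i), π h (v j)⟫ = ⟪π′ g (w i), π′ h (w j)⟫` for all `g, h, i, j` and the orbits `G · v`, `G · w` have dense spans,
the unitary `U` of §1 on the index set `G × ι` (`U (π g (v i)) = π′ g (w i)`) intertwines `π` and `π′` (checked on the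
dense span of the orbit, `ContinuousLinearMap.ext_on`), so it is an isometric `π.Equiv π′` with `e (v i) = w i`.
[cite: Folland1995, §3.3 Prop. 3.15 and Thm. 3.20] [cite: Dixmier1977, Prop. 2.4.1 and 13.1.3] -/
theorem exists_equiv_isometry_of_inner_orbit_eq
    (h : ∀ (g g' : G) (i j : ι), ⟪π g (v i), π g' (v j)⟫_ℂ = ⟪π' g (w i), π' g' (w j)⟫_ℂ)
    (hv : Dense (Submodule.span ℂ (Set.range fun p : G × ι => π p.1 (v p.2)) : Set E))
    (hw : Dense (Submodule.span ℂ (Set.range fun p : G × ι => π' p.1 (w p.2)) : Set E')) :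
    ∃ e : π.Equiv π', Isometry e ∧ ∀ i, e (v i) = w i := by
  obtain ⟨U, hU⟩ := exists_linearIsometryEquiv_of_inner_eq (fun p : G × ι => π p.1 (v p.2))
    (fun p : G × ι => π' p.1 (w p.2)) (fun p q => h p.1 q.1 p.2 q.2) hv hw
  have heq : ∀ g : G, (U.toContinuousLinearEquiv : E →L[ℂ] E') ∘L (π g) =
      (π' g) ∘L (U.toContinuousLinearEquiv : E →L[ℂ] E') := by
    intro g
    refine ContinuousLinearMap.ext_on hv ?_
    rintro _ ⟨⟨g', i⟩, rfl⟩
    change U (π g (π g' (v i))) = π' g (U (π g' (v i)))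
    rw [← mul_apply_eq_comp, ← map_mul, hU (g * g', i), hU (g', i), map_mul,
      mul_apply_eq_comp]
  refine ⟨ContRepresentation.Equiv.mk U.toContinuousLinearEquiv heq, ?_, fun i => ?_⟩
  · exact U.isometry
  · have h1 := hU (1, i)
    simp only [map_one, one_apply_eq_self] at h1
    exact h1

/-- Hence `π` and `π′` are unitarily equivalent (★ `AreUnitarilyEquivalent`). [cite: Folland1995, §3.3 Thm. 3.20]
[cite: Dixmier1977, 13.1.3] -/
theorem areUnitarilyEquivalent_of_inner_orbit_eq
    (h : ∀ (g g' : G) (i j : ι), ⟪π g (v i), π g' (v j)⟫_ℂ = ⟪π' g (w i), π' g' (w j)⟫_ℂ)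
    (hv : Dense (Submodule.span ℂ (Set.range fun p : G × ι => π p.1 (v p.2)) : Set E))
    (hw : Dense (Submodule.span ℂ (Set.range fun p : G × ι => π' p.1 (w p.2)) : Set E')) :
    ContRepresentation.AreUnitarilyEquivalent π π' := by
  obtain ⟨e, he, -⟩ := exists_equiv_isometry_of_inner_orbit_eq π π' v w h hv hw
  exact ⟨e, he⟩

/-- For UNITARY `π`, `π′`, equality of MATRIX COEFFICIENTS `⟪π g (v i), v j⟫ = ⟪π′ g (w i), w j⟫` gives equality of the
orbit Gram kernels (`⟪π g x, π h y⟫ = ⟪π (h⁻¹ g) x, y⟫`). [cite: Folland1995, §3.3 Prop. 3.15] -/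
theorem inner_orbit_eq_of_matrixCoeff_eq (hπ : π.IsUnitary) (hπ' : π'.IsUnitary)
    (h : ∀ (g : G) (i j : ι), ⟪π g (v i), v j⟫_ℂ = ⟪π' g (w i), w j⟫_ℂ) (g g' : G) (i j : ι) :
    ⟪π g (v i), π g' (v j)⟫_ℂ = ⟪π' g (w i), π' g' (w j)⟫_ℂ := by
  rw [← hπ.inner_map_map g'⁻¹, ← hπ'.inner_map_map g'⁻¹]
  simp only [← mul_apply_eq_comp, ← map_mul, inv_mul_cancel, map_one, one_apply_eq_self]
  exact h _ i j

/-- **Unitary representations with a pair of families of vectors having the same matrix coefficients and dense orbit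
spans are unitarily equivalent**, by an isometric equivalence matching the families. [cite: Folland1995, §3.3 Thm. 3.20]
[cite: Dixmier1977, Prop. 2.4.1 and 13.1.3] -/
theorem exists_equiv_isometry_of_matrixCoeff_eq (hπ : π.IsUnitary) (hπ' : π'.IsUnitary)
    (h : ∀ (g : G) (i j : ι), ⟪π g (v i), v j⟫_ℂ = ⟪π' g (w i), w j⟫_ℂ)
    (hv : Dense (Submodule.span ℂ (Set.range fun p : G × ι => π p.1 (v p.2)) : Set E))
    (hw : Dense (Submodule.span ℂ (Set.range fun p : G × ι => π' p.1 (w p.2)) : Set E')) :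
    ∃ e : π.Equiv π', Isometry e ∧ ∀ i, e (v i) = w i :=
  exists_equiv_isometry_of_inner_orbit_eq π π' v w (inner_orbit_eq_of_matrixCoeff_eq π π' v w hπ hπ' h) hv hw

/-! ## §3 Irreducible representations: the orbit of a non-zero family spans a dense subspace -/

omit [CompleteSpace E] in
/-- The span of the orbit `{π g (v i)}` is `π`-stable. [cite: Dixmier1977, 13.1.3] -/
theorem apply_mem_span_orbit (g : G) {x : E}
    (hx : x ∈ Submodule.span ℂ (Set.range fun p : G × ι => π p.1 (v p.2))) :
    π g x ∈ Submodule.span ℂ (Set.range fun p : G × ι => π p.1 (v p.2)) := by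
  induction hx using Submodule.span_induction with
  | mem y hy =>
    obtain ⟨⟨g', i⟩, rfl⟩ := hy
    refine Submodule.subset_span ⟨(g * g', i), ?_⟩
    change π (g * g') (v i) = π g (π g' (v i))
    rw [map_mul, mul_apply_eq_comp]
  | zero => rw [map_zero]; exact Submodule.zero_mem _
  | add y z _ _ hy hz => rw [map_add]; exact Submodule.add_mem _ hy hz
  | smul a y _ hy => rw [map_smul]; exact Submodule.smul_mem _ a hy

omit [CompleteSpace E] in
/-- **For a topologically irreducible `π`, the orbit of a family with a non-zero member spans a DENSE subspace**: its
closure is a non-zero closed `π`-stable subspace (★ `ClosedSubrep`), hence everything. [cite: Dixmier1977, 13.1.3 and 13.1.5]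
[cite: Folland1995, §3.1 Prop. 3.4] -/
theorem dense_span_orbit_of_isTopIrreducible (hirr : π.IsTopIrreducible) {i₀ : ι} (h0 : v i₀ ≠ 0) :
    Dense (Submodule.span ℂ (Set.range fun p : G × ι => π p.1 (v p.2)) : Set E) := by
  set S : Submodule ℂ E := Submodule.span ℂ (Set.range fun p : G × ι => π p.1 (v p.2)) with hS
  -- the closure of the span of the orbit, as a closed subrepresentation
  let W : ContRepresentation.ClosedSubrep π :=
    { toSubmodule := S.topologicalClosure
      apply_mem_toSubmodule := fun g x hx =>
        map_mem_closure (π g).continuous hx fun y hy => apply_mem_span_orbit π v g hy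
      isClosed' := S.isClosed_topologicalClosure }
  have hW : W ≠ ⊥ := by
    intro hbot
    have hmem : v i₀ ∈ W := by
      change v i₀ ∈ S.topologicalClosure
      refine S.le_topologicalClosure (Submodule.subset_span ⟨(1, i₀), ?_⟩)
      change π 1 (v i₀) = v i₀
      rw [map_one, one_apply_eq_self]
    rw [hbot, ContRepresentation.ClosedSubrep.mem_bot] at hmem
    exact h0 hmem
  haveI : IsSimpleOrder (ContRepresentation.ClosedSubrep π) := hirr
  have htop : W = ⊤ := (eq_bot_or_eq_top W).resolve_left hW
  have hcl : S.topologicalClosure = ⊤ := by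
    change W.toSubmodule = ⊤
    rw [htop]
    rfl
  exact Submodule.dense_iff_topologicalClosure_eq_top.2 hcl

/-- **Irreducible unitary representations with a pair of families of vectors having the same matrix coefficients are
unitarily equivalent**, by an isometric equivalence matching the families (density of the orbit spans is automatic from
irreducibility once one `v i₀ ≠ 0`; then `w i₀ ≠ 0` from `‖w i₀‖ = ‖v i₀‖`).  The form «an irreducible unitary
representation is determined by a non-zero matrix coefficient» of the GNS uniqueness theorem.
[cite: Folland1995, §3.3 Cor. 3.24] [cite: Dixmier1977, Prop. 2.4.1 and 13.1.3] -/
theorem exists_equiv_isometry_of_matrixCoeff_eq_of_isTopIrreducible (hπ : π.IsUnitary) (hπ' : π'.IsUnitary)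
    (hirr : π.IsTopIrreducible) (hirr' : π'.IsTopIrreducible) {i₀ : ι} (h0 : v i₀ ≠ 0)
    (h : ∀ (g : G) (i j : ι), ⟪π g (v i), v j⟫_ℂ = ⟪π' g (w i), w j⟫_ℂ) :
    ∃ e : π.Equiv π', Isometry e ∧ ∀ i, e (v i) = w i := by
  have h0' : w i₀ ≠ 0 := by
    intro hw0
    have h1 := h 1 i₀ i₀
    rw [map_one, one_apply_eq_self, map_one, one_apply_eq_self, hw0, inner_zero_left,
      inner_self_eq_zero] at h1
    exact h0 h1
  exact exists_equiv_isometry_of_matrixCoeff_eq π π' v w hπ hπ' h (dense_span_orbit_of_isTopIrreducible π v hirr h0)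
    (dense_span_orbit_of_isTopIrreducible π' w hirr' h0')

/-- **Irreducible unitary representations with a pair of non-zero families of vectors having the same matrix
coefficients are unitarily equivalent** (★ `AreUnitarilyEquivalent`). [cite: Folland1995, §3.3 Cor. 3.24]
[cite: Dixmier1977, Prop. 2.4.1 and 13.1.3] -/
theorem areUnitarilyEquivalent_of_matrixCoeff_eq (hπ : π.IsUnitary) (hπ' : π'.IsUnitary)
    (hirr : π.IsTopIrreducible) (hirr' : π'.IsTopIrreducible) {i₀ : ι} (h0 : v i₀ ≠ 0)
    (h : ∀ (g : G) (i j : ι), ⟪π g (v i), v j⟫_ℂ = ⟪π' g (w i), w j⟫_ℂ) :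
    ContRepresentation.AreUnitarilyEquivalent π π' := by
  obtain ⟨e, he, -⟩ := exists_equiv_isometry_of_matrixCoeff_eq_of_isTopIrreducible π π' v w hπ hπ' hirr hirr' h0 h
  exact ⟨e, he⟩

end Rep

end Literature.RepresentationTheory

end
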